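import Summits.BirchSwinnertonDyer.BirchSwinnertonDyer.Theorems.SmallImageMuTransferAnalyticMuZeroX9TeichOrbitNonConstantAtOfTeichSpanGenAll
import Summits.BirchSwinnertonDyer.BirchSwinnertonDyer.Theses.SmallImageMuTransfer
import Summits.BirchSwinnertonDyer.BirchSwinnertonDyer.Theses.PrintX9
import HarnessLib

/-!
# Crux 19630 BY NAME, modulo CONJ B⁰: `TeichSpanGenAll → Theses.SmallImageMuTransfer.AnalyticMuZeroX9`
# (and the PrintX9 twin) — the dictionary of cell `bsd-f3-mu` read on the two routes that want item 19630

Cell `bsd-f3-mu`, seat `p1` (gen 5), `--supports stmt-BirchSwinnertonDyer-19630` (helper).  Director-bsd W-61 (INBOX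
2026-08-27T23:45:20Z): «the dictionary `TeichSpanGenAll → AnalyticMuZeroX9` … lands as a plain Theorems file — a
by-name reduction is tree knowledge, not a line».  The Theses-free work is
`Theorems/SmallImageMuTransferAnalyticMuZeroX9TeichOrbitNonConstantAtOfTeichSpanGenAll.lean`
(`TeichSpan.analyticMuZeroOnClassX9_of_teichSpanGenAll`); here only the two one-line readings with the ROUTE DECLS
BY NAME (both route files define `AnalyticMuZeroX9 := Rank1Residual.AnalyticMuZeroOnClassX9`):
`Theses.SmallImageMuTransfer.AnalyticMuZeroX9` (route SmallImageMuTransfer, crux #3) and `Theses.PrintX9.AnalyticMuZeroX9`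
(route PrintX9, crux r3).  B⁰ = `TeichSpan.TeichSpanGenAll` (p586637; cell conjecture AN-14, CANDIDATES row 34, BANKED
by W-61) is DISPLAYED as the hypothesis; item 19630 stays OPEN.  Theorems only; no named fact; beyond-print theorem:
no.  BSD is not proved by any of this.  References: [GreenbergLNM1716] Conj. 1.11; [MazurTateTeitelbaum1986Invent] §I.10.
-/

-- the summit namespace repeats `BirchSwinnertonDyer` by design (summit = problem); linter moot
set_option linter.dupNamespace false

noncomputable section

namespace Summit.BirchSwinnertonDyer.BirchSwinnertonDyer.Cruxes.AnalyticMuZeroX9.TeichSpan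

/-- **Crux 19630 of route SmallImageMuTransfer BY NAME, modulo CONJ B⁰**: `TeichSpanGenAll →
Theses.SmallImageMuTransfer.AnalyticMuZeroX9` (for every X9 pair `(E, p)` and every newform `f` of `E`, some coefficient
of `L_p(f, α_E)` is a `p`-adic unit).  The route decl is `Rank1Residual.AnalyticMuZeroOnClassX9` by definition; the
content is `analyticMuZeroOnClassX9_of_teichSpanGenAll` (B⁰ ⟹ orbit non-constancy ⟹ AN-S1).
[cite: GreenbergLNM1716, §1 Conj. 1.11] [cite: MazurTateTeitelbaum1986Invent, §I.10–I.13] -/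
theorem analyticMuZeroX9_of_teichSpanGenAll (hB : TeichSpanGenAll) :
    Summit.BirchSwinnertonDyer.BirchSwinnertonDyer.Theses.SmallImageMuTransfer.AnalyticMuZeroX9 :=
  analyticMuZeroOnClassX9_of_teichSpanGenAll hB

/-- **Crux r3 of route PrintX9 BY NAME, modulo CONJ B⁰**: `TeichSpanGenAll → Theses.PrintX9.AnalyticMuZeroX9`
(same definiens `Rank1Residual.AnalyticMuZeroOnClassX9`).
[cite: GreenbergLNM1716, §1 Conj. 1.11] [cite: MazurTateTeitelbaum1986Invent, §I.10–I.13] -/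
theorem printX9_analyticMuZeroX9_of_teichSpanGenAll (hB : TeichSpanGenAll) :
    Summit.BirchSwinnertonDyer.BirchSwinnertonDyer.Theses.PrintX9.AnalyticMuZeroX9 :=
  analyticMuZeroOnClassX9_of_teichSpanGenAll hB

end Summit.BirchSwinnertonDyer.BirchSwinnertonDyer.Cruxes.AnalyticMuZeroX9.TeichSpan

end
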